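import Summits.ResolutionOfSingularities.ResolutionOfSingularities.Theorems.EquisingularLiftEquisingularLiftNatDefTowerBQuadPrimePointResolutionThree
import Summits.ResolutionOfSingularities.ResolutionOfSingularities.Theorems.EquisingularLiftEquisingularLiftNatNDRungClosure
import Summits.ResolutionOfSingularities.ResolutionOfSingularities.Theorems.EquisingularLiftEquisingularLiftNatNDFrameRegular
import Summits.ResolutionOfSingularities.ResolutionOfSingularities.Theorems.EquisingularLiftEquisingularLiftNatNDInvariantsP
import Summits.ResolutionOfSingularities.ResolutionOfSingularities.Theorems.EquisingularLiftEquisingularLiftNatNDRoundPropsP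
import Summits.ResolutionOfSingularities.ResolutionOfSingularities.Theorems.EquisingularLiftEquisingularLiftNatNDTransportInitP
import Summits.ResolutionOfSingularities.ResolutionOfSingularities.Theorems.EquisingularLiftEquisingularLiftNatNDTransportStepP
import Summits.ResolutionOfSingularities.ResolutionOfSingularities.Theorems.EquisingularLiftEquisingularLiftNatNDTransportEndP
import Summits.ResolutionOfSingularities.ResolutionOfSingularities.Theorems.EquisingularLiftEquisingularLiftNatNDInvPersistsP
import Summits.ResolutionOfSingularities.ResolutionOfSingularities.Theorems.EquisingularLiftEquisingularLiftNatNDRoundModelSplitP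
import Summits.ResolutionOfSingularities.ResolutionOfSingularities.Theorems.EquisingularLiftEquisingularLiftNatPrefixReachClosedLN
import Summits.ResolutionOfSingularities.ResolutionOfSingularities.Theorems.EquisingularLiftEquisingularLiftNatResidueHypDefs
import Summits.ResolutionOfSingularities.ResolutionOfSingularities.Theorems.EquisingularLiftEquisingularLiftNatResidueHypDefsND
import HarnessLib

/-!
# [OURS · L1 W4.5(b) · EL♮(3)] ND-LEAVES RUNG, POINTWISE — `…NatNDLeavesRungP` (desk R33 (β) «ND-LEAVES» / R36 (α) L0 / R37 (β): hand (L-Ω) = the text owner; THE 38th's THEOREM)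

OURS · L1 W4.5(b) · EL♮(3) stmt-ResolutionOfSingularities-20148 (parent EL♮ stmt-…-20038) · counted 0 · AI-written (res-L1-w45b-idea-1 g23 SPEC K6-loc
`Cruxes/EquisingularLiftNatThree/NDLeavesRungK6Loc.lean` sha16 4f9cf29f52e7d351, 0 sorries over the tree — the declarations below VERBATIM, generator `k6/make_k6.py --product rungP`;
assembled and filed by the text owner res-L1-w45b-lead-2 g7), weaker than expert review; nothing of [Hironaka2017] asserted; EL♮(3) itself is NOT proved: the rung is
CONDITIONAL on the registered NEED-FACT lineage (T-k) `EmbeddedCurveLiftFact` (like every rung since the 19th) and serves a HYPOTHESIS (#22) `IsoHypReachNDLeavesP`.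
CONTENT: the A⁗-prefix predicate `PrefixReachBQuadPrime` (blob #21's `∀ Q`-part), `isoHypDefTowerBQuadPrime_iff`, the blobs (K6-1) `IsoHypReachNDLeaves` / (K6-1P)
`IsoHypReachNDLeavesP` («an A⁗-prefix ends at a stage carrying the locally-Noetherian resp. POINTWISE ND invariant», ports ✓ p643982 / ✓ p648724) with `isoHypReachNDLeavesP_of`,
the derived `₀` round `ND.transportRoundLN₀` / `ND.roundAtNDFrameLN₀` (over nose-w4's ✓ `…NatNDRoundModelSplitP` compositions and the D2 bricks ✓ p650234 `ND.transportInit₀`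
(stub-2) · ✓ p650056 `ND.transportStep₀` (iso-w1) · ✓ p649938 `ND.transportEnd₀` (iso-w2), R0 ✓ p648331 (iso-w1)), the pointwise round `ndInvLNP_round` (+ ✓ p650049
`ND.ndInvPersists₀`, nose-w4), the INCLUSIONS `isoHypReachNDLeaves_of_isoHypNDWon` (#19-won ⊆ K6-1, via ✓ p645490 `ND.ndInv_init`) and S-T56′
`isoHypReachNDLeavesP_of_isoHypDefTowerBQuadPrime` (#21 ⊆ K6-1P, via stub-2's ✓ `…NatPrefixReachClosedLN`; slot `PrefixReachClosedLN` + `prefixReachClosedLN`), the gluing theorem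
(K6-2P) `target_elnat_of_prefix_then_ndRoundsP` (K5″ ✓ p634794 at `Reach := B‴ ∨ toric` with blob #21's letters; HSUB(toric) = ✓ p647090 `ND.hsub_strataLift`), THE P-RUNG
`nd_leaves_rung_threeP : EmbeddedCurveLiftFact → … → IsoHypReachNDLeavesP k 3 H ι → ELNatConclusionO k 3 H ι` and v2's rung `nd_leaves_rung_three_of_P`.
`--kind definition --supports stmt-ResolutionOfSingularities-20148 --as helper` (three named-hypothesis defs + proved plumbing; no instance, no notation; standard axioms).
-/

set_option linter.dupNamespace false
set_option linter.overlappingInstances false -- K5′-style signatures carry `[IsDomain O] [IsDiscreteValuationRing O]`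

noncomputable section

open CategoryTheory CategoryTheory.Limits AlgebraicGeometry TopologicalSpace Topology IsLocalRing
open Literature.AlgebraicGeometry.Resolution
open AlgebraicGeometry.Scheme.IdealSheafData
open Summit.ResolutionOfSingularities.ResolutionOfSingularities.Theses.EquisingularLift.Split
open Summit.ResolutionOfSingularities.ResolutionOfSingularities.Cruxes.EquisingularLift.StrataSplit

attribute [local instance] MvPolynomial.gradedAlgebra

namespace Summit.ResolutionOfSingularities.ResolutionOfSingularities.Cruxes.EquisingularLiftNat.Sections

/-- **The A⁗-PREFIX REACH predicate** `PrefixReachBQuadPrime k n H ι F' ρ' T'`: the stage `(F', ρ', T')` is reached from `(ℙⁿ_k, 𝟙, range ι)` through every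
point-resolution motive `Q` closed under blob #21's two clauses (point steps + B‴ towers at any stage; lettered B⁗ towers at the initial stage) — blob #21
`IsoHypDefTowerBQuadPrime`'s `∀ Q`-part VERBATIM with its end clause removed (`isoHypDefTowerBQuadPrime_iff`).
[OURS · L1 W4.5b · named predicate, no mathematical content of its own] -/
def PrefixReachBQuadPrime (k : Type) [Field k] [IsAlgClosed k] (n : ℕ) (H : AlgebraicGeometry.Scheme.{0})
    (ι : H ⟶ (Literature.AlgebraicGeometry.Motives.projectiveSpace n k).left) (F' : AlgebraicGeometry.Scheme.{0})
    (ρ' : F' ⟶ (Literature.AlgebraicGeometry.Motives.projectiveSpace n k).left) (T' : Set F') : Prop :=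
  (∀ Q : (∀ F₁ : AlgebraicGeometry.Scheme.{0}, (F₁ ⟶ (Literature.AlgebraicGeometry.Motives.projectiveSpace n k).left) → Set F₁ → Prop), Q (Literature.AlgebraicGeometry.Motives.projectiveSpace n k).left (CategoryTheory.CategoryStruct.id (Literature.AlgebraicGeometry.Motives.projectiveSpace n k).left) (Set.range ι) → (∀ (F₁ F₂ : AlgebraicGeometry.Scheme.{0}) (ρ : F₁ ⟶ (Literature.AlgebraicGeometry.Motives.projectiveSpace n k).left) (T₁ : Set F₁) (x : ↥(AlgebraicGeometry.Scheme.IdealSheafData.vanishingIdeal (⟨closure T₁, isClosed_closure⟩ : TopologicalSpace.Closeds F₁)).subscheme) (υ : F₂ ⟶ F₁) (hx : IsClosed ({((AlgebraicGeometry.Scheme.IdealSheafData.vanishingIdeal (⟨closure T₁, isClosed_closure⟩ : TopologicalSpace.Closeds F₁)).subschemeι x : F₁)} : Set F₁)), Q F₁ ρ T₁ → ¬ IsRegularLocalRing ((AlgebraicGeometry.Scheme.IdealSheafData.vanishingIdeal (⟨closure T₁, isClosed_closure⟩ : TopologicalSpace.Closeds F₁)).subscheme.presheaf.stalk x) → IsRegularLocalRing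 (F₁.presheaf.stalk ((AlgebraicGeometry.Scheme.IdealSheafData.vanishingIdeal (⟨closure T₁, isClosed_closure⟩ : TopologicalSpace.Closeds F₁)).subschemeι x)) → Literature.AlgebraicGeometry.Resolution.IsBlowup υ (AlgebraicGeometry.Scheme.IdealSheafData.vanishingIdeal (⟨{((AlgebraicGeometry.Scheme.IdealSheafData.vanishingIdeal (⟨closure T₁, isClosed_closure⟩ : TopologicalSpace.Closeds F₁)).subschemeι x : F₁)}, hx⟩ : TopologicalSpace.Closeds F₁)) → Q F₂ (CategoryTheory.CategoryStruct.comp υ ρ) (closure (υ ⁻¹' (T₁ \ {((AlgebraicGeometry.Scheme.IdealSheafData.vanishingIdeal (⟨closure T₁, isClosed_closure⟩ : TopologicalSpace.Closeds F₁)).subschemeι x : F₁)}))) ∧ (∀ (F₉ : AlgebraicGeometry.Scheme.{0}) (β : F₉ ⟶ F₂) (T₉ : Set F₉), ReachTowerBTriplePrime F₁ F₂ υ ((AlgebraicGeometry.Scheme.IdealSheafData.vanishingIdeal (⟨closure T₁, isClosed_closure⟩ : TopologicalSpace.Closeds F₁)).subschemeι x) (closure (υ ⁻¹' (T₁ \ {((AlgebraicGeometry.Scheme.IdealSheafData.vanishingIdeal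 (⟨closure T₁, isClosed_closure⟩ : TopologicalSpace.Closeds F₁)).subschemeι x : F₁)}))) F₉ β T₉ → Q F₉ (CategoryTheory.CategoryStruct.comp (CategoryTheory.CategoryStruct.comp β υ) ρ) T₉))  → (∀ (F₂ : AlgebraicGeometry.Scheme.{0}) (x₀ : ↥(AlgebraicGeometry.Scheme.IdealSheafData.vanishingIdeal (⟨closure (Set.range ι), isClosed_closure⟩ : TopologicalSpace.Closeds (Literature.AlgebraicGeometry.Motives.projectiveSpace n k).left)).subscheme) (υ : F₂ ⟶ (Literature.AlgebraicGeometry.Motives.projectiveSpace n k).left) (hx₀ : IsClosed ({((AlgebraicGeometry.Scheme.IdealSheafData.vanishingIdeal (⟨closure (Set.range ι), isClosed_closure⟩ : TopologicalSpace.Closeds (Literature.AlgebraicGeometry.Motives.projectiveSpace n k).left)).subschemeι x₀ : (Literature.AlgebraicGeometry.Motives.projectiveSpace n k).left)} : Set (Literature.AlgebraicGeometry.Motives.projectiveSpace n k).left)) (Ls₂ : List (Set F₂)), ¬ IsRegularLocalRing ((AlgebraicGeometry.Scheme.IdealSheafData.vanishingIdeal (⟨closure (Set.range ι), isClosed_closure⟩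 : TopologicalSpace.Closeds (Literature.AlgebraicGeometry.Motives.projectiveSpace n k).left)).subscheme.presheaf.stalk x₀) → IsRegularLocalRing (((Literature.AlgebraicGeometry.Motives.projectiveSpace n k).left).presheaf.stalk ((AlgebraicGeometry.Scheme.IdealSheafData.vanishingIdeal (⟨closure (Set.range ι), isClosed_closure⟩ : TopologicalSpace.Closeds (Literature.AlgebraicGeometry.Motives.projectiveSpace n k).left)).subschemeι x₀ : (Literature.AlgebraicGeometry.Motives.projectiveSpace n k).left)) → Literature.AlgebraicGeometry.Resolution.IsBlowup υ (AlgebraicGeometry.Scheme.IdealSheafData.vanishingIdeal (⟨{((AlgebraicGeometry.Scheme.IdealSheafData.vanishingIdeal (⟨closure (Set.range ι), isClosed_closure⟩ : TopologicalSpace.Closeds (Literature.AlgebraicGeometry.Motives.projectiveSpace n k).left)).subschemeι x₀ : (Literature.AlgebraicGeometry.Motives.projectiveSpace n k).left)}, hx₀⟩ : TopologicalSpace.Closeds (Literature.AlgebraicGeometry.Motives.projectiveSpace n k).left)) → (letI := MvPolynomial.gradedAlgebra (σ := Fin (n + 1)) (R := k); ∀ L ∈ Ls₂, ∃ ℓ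 : MvPolynomial (Fin (n + 1)) k, ℓ.IsHomogeneous 1 ∧ ℓ ≠ 0 ∧ ((AlgebraicGeometry.Scheme.IdealSheafData.vanishingIdeal (⟨closure (Set.range ι), isClosed_closure⟩ : TopologicalSpace.Closeds (Literature.AlgebraicGeometry.Motives.projectiveSpace n k).left)).subschemeι x₀ : (Literature.AlgebraicGeometry.Motives.projectiveSpace n k).left) ∈ {y : (Literature.AlgebraicGeometry.Motives.projectiveSpace n k).left | ℓ ∈ (y : ProjectiveSpectrum (MvPolynomial.homogeneousSubmodule (Fin (n + 1)) k)).asHomogeneousIdeal} ∧ ¬ (Set.range ι ⊆ {y : (Literature.AlgebraicGeometry.Motives.projectiveSpace n k).left | ℓ ∈ (y : ProjectiveSpectrum (MvPolynomial.homogeneousSubmodule (Fin (n + 1)) k)).asHomogeneousIdeal}) ∧ L = closure (υ ⁻¹' ({y : (Literature.AlgebraicGeometry.Motives.projectiveSpace n k).left | ℓ ∈ (y : ProjectiveSpectrum (MvPolynomial.homogeneousSubmodule (Fin (n + 1)) k)).asHomogeneousIdeal} \ {((AlgebraicGeometry.Scheme.IdealSheafData.vanishingIdeal (⟨closure (Set.range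 ι), isClosed_closure⟩ : TopologicalSpace.Closeds (Literature.AlgebraicGeometry.Motives.projectiveSpace n k).left)).subschemeι x₀ : (Literature.AlgebraicGeometry.Motives.projectiveSpace n k).left)}))) → ∀ (F₉ : AlgebraicGeometry.Scheme.{0}) (β : F₉ ⟶ F₂) (T₉ : Set F₉), ReachTowerBQuadPrime (Literature.AlgebraicGeometry.Motives.projectiveSpace n k).left F₂ υ ((AlgebraicGeometry.Scheme.IdealSheafData.vanishingIdeal (⟨closure (Set.range ι), isClosed_closure⟩ : TopologicalSpace.Closeds (Literature.AlgebraicGeometry.Motives.projectiveSpace n k).left)).subschemeι x₀ : (Literature.AlgebraicGeometry.Motives.projectiveSpace n k).left) (closure (υ ⁻¹' (Set.range ι \ {((AlgebraicGeometry.Scheme.IdealSheafData.vanishingIdeal (⟨closure (Set.range ι), isClosed_closure⟩ : TopologicalSpace.Closeds (Literature.AlgebraicGeometry.Motives.projectiveSpace n k).left)).subschemeι x₀ : (Literature.AlgebraicGeometry.Motives.projectiveSpace n k).left)}))) Ls₂ F₉ β T₉ → Q F₉ (CategoryTheory.CategoryStruct.comp β υ) T₉) → Q F' ρ' T')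

/-- Blob #21 `IsoHypDefTowerBQuadPrime` = «an A⁗-prefix reaches a stage with REGULAR reduced strict transform» (definitional). [OURS · pure logic] -/
theorem isoHypDefTowerBQuadPrime_iff (k : Type) [Field k] [IsAlgClosed k] (n : ℕ) (H : AlgebraicGeometry.Scheme.{0})
    (ι : H ⟶ (Literature.AlgebraicGeometry.Motives.projectiveSpace n k).left) :
    IsoHypDefTowerBQuadPrime k n H ι ↔
      ∃ (F' : AlgebraicGeometry.Scheme.{0}) (ρ' : F' ⟶ (Literature.AlgebraicGeometry.Motives.projectiveSpace n k).left) (T' : Set F'),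
        PrefixReachBQuadPrime k n H ι F' ρ' T' ∧ Literature.AlgebraicGeometry.Resolution.Scheme.IsRegular (AlgebraicGeometry.Scheme.IdealSheafData.vanishingIdeal (⟨closure T', isClosed_closure⟩ : TopologicalSpace.Closeds F')).subscheme :=
  Iff.rfl

/-- **(K6-1) `IsoHypReachNDLeaves k n H ι`** — «an A⁗-prefix ends at a stage with ND LEAVES»: some stage `(F, ρ, T)` reached by `PrefixReachBQuadPrime` carries
the locally-Noetherian ND invariant `ND.NDInvCLN n k m F ρ T` (port ✓ p643982 over ✓ p639684: `F` regular and locally Noetherian, `T` closed, the non-regular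
points of the reduced closure of `T` = `m` points, each with `ND.IsNDFrameAt` data).  House style R21″: ONE blob; the ONE extra hypothesis of the rung
`nd_leaves_rung_three`. [OURS · L1 W4.5b · named hypothesis, no mathematical content of its own] -/
def IsoHypReachNDLeaves (k : Type) [Field k] [IsAlgClosed k] (n : ℕ) (H : AlgebraicGeometry.Scheme.{0})
    (ι : H ⟶ (Literature.AlgebraicGeometry.Motives.projectiveSpace n k).left) : Prop :=
  ∃ (F : AlgebraicGeometry.Scheme.{0}) (ρ : F ⟶ (Literature.AlgebraicGeometry.Motives.projectiveSpace n k).left) (T : Set F) (m : ℕ),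
    PrefixReachBQuadPrime k n H ι F ρ T ∧ ND.NDInvCLN n k m F ρ T

namespace ND

section L0

variable (n : ℕ) (k : Type) [Field k]

/-- **(B4β-LN₀) DERIVED** from the model bricks (tree, BY NAME) and the three `₀` transport bricks. [OURS · pure logic] -/
theorem transportRoundLN₀ [IsAlgClosed k] : TransportRoundLN₀ n k :=
  transportRoundLN₀_of_toricStage n k (playFacts n) (modelInit n k) (modelStep n k) (modelEnd n k) (transportInit₀ n k) (transportStep₀ n k) (transportEnd₀ n k)

/-- **(B4α′-LN₀) DERIVED**. [OURS · pure logic] -/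
theorem roundAtNDFrameLN₀ [IsAlgClosed k] : RoundAtNDFrameLN₀ n k :=
  roundAtNDFrameLN₀_of_model n k (modelRound n k) (transportRoundLN₀ n k)

end L0

end ND

/-- **(K6-1P) `IsoHypReachNDLeavesP k n H ι`** — (K6-1) with the pointwise leaf clause `ND.NDInvCLNP` (no global regularity of the prefix end). [OURS · named hypothesis] -/
def IsoHypReachNDLeavesP (k : Type) [Field k] [IsAlgClosed k] (n : ℕ) (H : AlgebraicGeometry.Scheme.{0})
    (ι : H ⟶ (Literature.AlgebraicGeometry.Motives.projectiveSpace n k).left) : Prop :=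
  ∃ (F : AlgebraicGeometry.Scheme.{0}) (ρ : F ⟶ (Literature.AlgebraicGeometry.Motives.projectiveSpace n k).left) (T : Set F) (m : ℕ),
    PrefixReachBQuadPrime k n H ι F ρ T ∧ ND.NDInvCLNP n k m F ρ T

/-- Monotonicity of the blobs: (K6-1) ⇒ (K6-1P). [OURS · pure logic] -/
theorem isoHypReachNDLeavesP_of (k : Type) [Field k] [IsAlgClosed k] (n : ℕ) (H : AlgebraicGeometry.Scheme.{0})
    (ι : H ⟶ (Literature.AlgebraicGeometry.Motives.projectiveSpace n k).left) (h : IsoHypReachNDLeaves k n H ι) : IsoHypReachNDLeavesP k n H ι := by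
  obtain ⟨F, ρ, T, m, hpre, hND⟩ := h
  exact ⟨F, ρ, T, m, hpre, ND.ndInvCLNP_of_ndInvCLN n k hND⟩

/-- **MONOTONICITY** — the ND-K5 stub's hypothesis (`IsoHypNDWon` + finitely many non-regular points) is the EMPTY-PREFIX case of `IsoHypReachNDLeaves`, by
✓ p645490 `ND.ndInv_init` (B4γ) at floor 0 (+ `ℙⁿ_k` locally Noetherian, `range ι` closed).  So the 37th cut may REPLACE the ND blob by the ND-leaves blob.
[OURS · pure logic over ✓ p645490] -/
theorem isoHypReachNDLeaves_of_isoHypNDWon (n : ℕ) (p : ℕ) (hp : p.Prime) (k : Type) [Field k] [CharP k p] [IsAlgClosed k]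
    (H : AlgebraicGeometry.Scheme.{0}) (ι : H ⟶ (Literature.AlgebraicGeometry.Motives.projectiveSpace n k).left)
    (hι : AlgebraicGeometry.IsClosedImmersion ι) (hH : AlgebraicGeometry.IsIntegral H)
    (hloc : ∀ y : (Literature.AlgebraicGeometry.Motives.projectiveSpace n k).left,
      ∃ U : (Literature.AlgebraicGeometry.Motives.projectiveSpace n k).left.affineOpens,
        y ∈ (U : (Literature.AlgebraicGeometry.Motives.projectiveSpace n k).left.Opens) ∧ (ι.ker.ideal U).IsPrincipal)
    (hfin : Set.Finite {x : H | ¬ IsRegularLocalRing (H.presheaf.stalk x)}) (hND : IsoHypNDWon k n H ι) :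
    IsoHypReachNDLeaves k n H ι := by
  obtain ⟨m, hm⟩ := ND.ndInv_init n p hp k H ι hι hH hloc hfin hND
  haveI := hι
  have hLNP : IsLocallyNoetherian (Literature.AlgebraicGeometry.Motives.projectiveSpace n k).left :=
    AlgebraicGeometry.LocallyOfFiniteType.isLocallyNoetherian (Literature.AlgebraicGeometry.Motives.projectiveSpace n k).hom
  exact ⟨_, _, _, m, fun Q hQ0 _ _ => hQ0, ⟨hm, ι.isClosedEmbedding.isClosed_range⟩, hLNP⟩

/-- **S-T56′ SLOT `PrefixReachClosedLN k n`** (crit-3; desk R36 (L-P)): the A⁗ prefix reach delivers a CLOSED `T` on a LOCALLY NOETHERIAN `F` (motive induction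
with `Q := «T closed ∧ F locally Noetherian»` — closed under point blow-ups and B‴/B⁗ towers of finite-type `k`-schemes; reach members are closures).  Typed as a
named statement UNDER `IsClosedImmersion ι` (v7: without it the zero-move stage `(ℙⁿ, 𝟙, range ι)` of a NON-closed `ι` satisfies `PrefixReachBQuadPrime`
trivially with `range ι` not closed — the unguarded v3–v6 slot was FALSE; every later stage carries a `closure (…)` or a tower end); proof optional (S-sized;
motive `Q F ρ T := IsLocallyNoetherian F ∧ IsClosed T`, nested with the tower motives `R`).  With it blob #21 becomes the `m = 0` sub-case of (K6-1P) (next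
theorem, PROVED). [OURS · statement (Prop)] -/
def PrefixReachClosedLN (k : Type) [Field k] [IsAlgClosed k] (n : ℕ) : Prop :=
  ∀ (H : AlgebraicGeometry.Scheme.{0}) (ι : H ⟶ (Literature.AlgebraicGeometry.Motives.projectiveSpace n k).left)
    (F : AlgebraicGeometry.Scheme.{0}) (ρ : F ⟶ (Literature.AlgebraicGeometry.Motives.projectiveSpace n k).left) (T : Set F),
    AlgebraicGeometry.IsClosedImmersion ι → PrefixReachBQuadPrime k n H ι F ρ T → IsClosed T ∧ IsLocallyNoetherian F

/-- **S-T56′ slot DISCHARGED** (v8): stub-2 g15's ✓ `…NatPrefixReachClosedLN` proves the guarded statement def-free with the hypothesis unfolded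
(`isClosed_and_isLocallyNoetherian_of_prefixReachBQuadPrime … [IsClosedImmersion ι] … (h : <body>)`); the named slot follows BY NAME. [OURS · one-liner] -/
theorem prefixReachClosedLN (k : Type) [Field k] [IsAlgClosed k] (n : ℕ) : PrefixReachClosedLN k n :=
  fun H ι F ρ T hι h => by
    haveI := hι
    exact isClosed_and_isLocallyNoetherian_of_prefixReachBQuadPrime k n H ι F ρ T h

/-- S-T56′ (PROVED — unconditionally since v8): blob #21 `IsoHypDefTowerBQuadPrime` ⇒ (K6-1P) at measure `0` (`S = ∅`; clause 2 from blob #21's end clause). [OURS · pure logic] -/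
theorem isoHypReachNDLeavesP_of_isoHypDefTowerBQuadPrime (k : Type) [Field k] [IsAlgClosed k] (n : ℕ) (H : AlgebraicGeometry.Scheme.{0})
    (ι : H ⟶ (Literature.AlgebraicGeometry.Motives.projectiveSpace n k).left) (hι : AlgebraicGeometry.IsClosedImmersion ι)
    (h : IsoHypDefTowerBQuadPrime k n H ι) : IsoHypReachNDLeavesP k n H ι := by
  obtain ⟨F, ρ, T, hpre, hreg⟩ := (isoHypDefTowerBQuadPrime_iff k n H ι).mp h
  obtain ⟨hT, hLN⟩ := prefixReachClosedLN k n H ι F ρ T hι hpre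
  refine ⟨F, ρ, T, 0, hpre, ⟨⟨∅, Finset.card_empty, fun z => ⟨fun _ => by simp, fun _ => hreg z⟩, fun x hx => by simp at hx⟩, hT⟩, hLN⟩
/-! ## §P (continued) — the pointwise gluing theorem (PROVED), the ONE brick, the P-rung, and v2's rung re-derived -/

/-- **(K6-2P) THE POINTWISE GLUING THEOREM** (any `n`; PROVED): (K6-2) VERBATIM with `ND.NDInvCLNP` for `ND.NDInvCLN` — `ND.rounds_resolve` is parametric in the
invariant and `ND.ndInvCLNP_end` replaces `ND.ndInvCLN_end`. [OURS · pure logic over K5″ ✓ p634794 · ✓ p638808 · ✓ p647090] -/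
theorem target_elnat_of_prefix_then_ndRoundsP (p : ℕ) : p.Prime → ∀ (k : Type) [Field k] [CharP k p] [IsAlgClosed k] (n : ℕ) (H :
    AlgebraicGeometry.Scheme.{0}) (ι : H ⟶ (Literature.AlgebraicGeometry.Motives.projectiveSpace n k).left), AlgebraicGeometry.IsClosedImmersion ι → AlgebraicGeometry.IsIntegral H →
    (∀ y : (Literature.AlgebraicGeometry.Motives.projectiveSpace n k).left, ∃ U : (Literature.AlgebraicGeometry.Motives.projectiveSpace n k).left.affineOpens, y ∈ (U :
    (Literature.AlgebraicGeometry.Motives.projectiveSpace n k).left.Opens) ∧ (ι.ker.ideal U).IsPrincipal) → (∀ (O : Type) [CommRing O] [IsDomain O] [IsDiscreteValuationRing O]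
    [IsAdicComplete (IsLocalRing.maximalIdeal O) O] [IsAlgClosed (IsLocalRing.ResidueField O)] (θ : O →+* k), Function.Surjective θ → ∀ (P : AlgebraicGeometry.Scheme.{0}) (q : P ⟶
    AlgebraicGeometry.Spec (.of O)) (Y : Set P) (Ch : ∀ X' : AlgebraicGeometry.Scheme.{0}, (X' ⟶ P) → Set X' → Prop), (∀ (X' X'' : AlgebraicGeometry.Scheme.{0}) (σ' : X' ⟶ P) (S' :
    Set X') (C : X'.IdealSheafData) (τ : X'' ⟶ X'), Ch X' σ' S' → Literature.AlgebraicGeometry.Resolution.IsBlowup τ C → Literature.AlgebraicGeometry.Resolution.Scheme.IsRegular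
    C.subscheme → AlgebraicGeometry.Flat (C.subschemeι ≫ σ' ≫ q) → σ' '' (C.support : Set X') ⊆ {y | ¬ IsGenericPoint y Y} → (C.support : Set X') ∩ (σ' ≫ q) ⁻¹'
    {IsLocalRing.closedPoint O} ⊆ S' → Ch X'' (τ ≫ σ') (closure (τ ⁻¹' (S' \ (C.support : Set X'))))) → (∀ (X' : AlgebraicGeometry.Scheme.{0}) (σ' : X' ⟶ P) (S' : Set X'), Ch X' σ'
    S' → Summit.ResolutionOfSingularities.ResolutionOfSingularities.Theses.EquisingularLift.Split.Chain P Y X' σ' S') → Y ⊆ q ⁻¹' {IsLocalRing.closedPoint O} → IsIrreducible Y →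
    IsClosed Y → AlgebraicGeometry.IsIntegral P → IsLocallyNoetherian P → Literature.AlgebraicGeometry.Resolution.Scheme.IsRegular P → AlgebraicGeometry.IsProper q →
    AlgebraicGeometry.SmoothOfRelativeDimension n q → ∀ (X' : AlgebraicGeometry.Scheme.{0}) (σ' : X' ⟶ P) (S' : Set X'), Ch X' σ' S' → AlgebraicGeometry.IsIntegral X' →
    IsLocallyNoetherian X' → Literature.AlgebraicGeometry.Resolution.Scheme.IsRegular X' → AlgebraicGeometry.IsDominant (σ' ≫ q) → ∀ (F₁ : AlgebraicGeometry.Scheme.{0}),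
    AlgebraicGeometry.IsIntegral F₁ → ∀ (j : F₁ ⟶ X') (t : F₁ ⟶ AlgebraicGeometry.Spec (.of k)), IsPullback j t (σ' ≫ q) (AlgebraicGeometry.Spec.map (CommRingCat.ofHom θ)) → ∀ (T₁ :
    Set F₁), IsClosed T₁ → IsIrreducible T₁ → j '' T₁ = S' → ∀ (x : F₁) (hx : IsClosed ({x} : Set F₁)) (U : X'.Opens), AlgebraicGeometry.Smooth (U.ι ≫ σ' ≫ q) → ∀ (s :
    AlgebraicGeometry.Spec (.of O) ⟶ X'), s ≫ σ' ≫ q = 𝟙 _ → s (IsLocalRing.closedPoint O) ∈ U → s (IsLocalRing.closedPoint O) = j x → ringKrullDim (X'.presheaf.stalk (s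
    (IsLocalRing.closedPoint O))) = ((n + 1 : ℕ) : WithBot ℕ∞) → IsRegularLocalRing (F₁.presheaf.stalk x) → (∀ c ∈ (s.ker.support : Set X'), ¬ IsGenericPoint (σ' c) Y) → ∀ (X₁ :
    AlgebraicGeometry.Scheme.{0}) (τ₁ : X₁ ⟶ X'), Literature.AlgebraicGeometry.Resolution.IsBlowup τ₁ s.ker → AlgebraicGeometry.IsIntegral X₁ → IsLocallyNoetherian X₁ →
    Literature.AlgebraicGeometry.Resolution.Scheme.IsRegular X₁ → AlgebraicGeometry.IsDominant ((τ₁ ≫ σ') ≫ q) → ∀ (F₂ : AlgebraicGeometry.Scheme.{0}), AlgebraicGeometry.IsIntegral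
    F₂ → ∀ (υ : F₂ ⟶ F₁), Literature.AlgebraicGeometry.Resolution.IsBlowup υ (AlgebraicGeometry.Scheme.IdealSheafData.vanishingIdeal (⟨{x}, hx⟩ : TopologicalSpace.Closeds F₁)) → ∀
    (j₂ : F₂ ⟶ X₁) (t₂ : F₂ ⟶ AlgebraicGeometry.Spec (.of k)), IsPullback j₂ t₂ ((τ₁ ≫ σ') ≫ q) (AlgebraicGeometry.Spec.map (CommRingCat.ofHom θ)) → j₂ ≫ τ₁ = υ ≫ j → (s.ker.comap
    τ₁).comap j₂ = (AlgebraicGeometry.Scheme.IdealSheafData.vanishingIdeal (⟨{x}, hx⟩ : TopologicalSpace.Closeds F₁)).comap υ → IsIrreducible (closure (υ ⁻¹' (T₁ \ {x}))) → Ch X₁ (τ₁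
    ≫ σ') (j₂ '' closure (υ ⁻¹' (T₁ \ {x}))) → ∀ (F₉ : AlgebraicGeometry.Scheme.{0}) (β : F₉ ⟶ F₂) (T₉ : Set F₉), ReachTowerBTriplePrime F₁ F₂ υ x (closure (υ ⁻¹' (T₁ \ {x}))) F₉ β
    T₉ → ∃ (X₉ : AlgebraicGeometry.Scheme.{0}) (σ₉ : X₉ ⟶ P) (S₉ : Set X₉) (j₉ : F₉ ⟶ X₉) (t₉ : F₉ ⟶ AlgebraicGeometry.Spec (.of k)), Ch X₉ σ₉ S₉ ∧ AlgebraicGeometry.IsIntegral X₉ ∧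
    IsLocallyNoetherian X₉ ∧ Literature.AlgebraicGeometry.Resolution.Scheme.IsRegular X₉ ∧ AlgebraicGeometry.IsDominant (σ₉ ≫ q) ∧ IsPullback j₉ t₉ (σ₉ ≫ q)
    (AlgebraicGeometry.Spec.map (CommRingCat.ofHom θ)) ∧ j₉ '' T₉ = S₉ ∧ IsClosed T₉ ∧ IsIrreducible T₉ ∧ AlgebraicGeometry.IsIntegral F₉) → (∀ (O : Type) [CommRing O] [IsDomain O]
    [IsDiscreteValuationRing O] [IsAdicComplete (IsLocalRing.maximalIdeal O) O] [IsAlgClosed (IsLocalRing.ResidueField O)] (θ : O →+* k), Function.Surjective θ →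
    (letI := MvPolynomial.gradedAlgebra (σ := Fin (n + 1)) (R := O); letI := MvPolynomial.gradedAlgebra (σ := Fin (n + 1)) (R := k); ∀ (φ : MvPolynomial.homogeneousSubmodule (Fin (n
    + 1)) O →+*ᵍ MvPolynomial.homogeneousSubmodule (Fin (n + 1)) k) (hφ' : HomogeneousIdeal.irrelevant (MvPolynomial.homogeneousSubmodule (Fin (n + 1)) k) ≤
    (HomogeneousIdeal.irrelevant (MvPolynomial.homogeneousSubmodule (Fin (n + 1)) O)).map φ), (∀ s, φ s = MvPolynomial.map θ s) → ∀ (Ch : ∀ X' : AlgebraicGeometry.Scheme.{0}, (X' ⟶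
    (AlgebraicGeometry.Proj (MvPolynomial.homogeneousSubmodule (Fin (n + 1)) O))) → Set X' → Prop), (∀ (X' X'' : AlgebraicGeometry.Scheme.{0}) (σ' : X' ⟶ (AlgebraicGeometry.Proj
    (MvPolynomial.homogeneousSubmodule (Fin (n + 1)) O))) (S' : Set X') (C : X'.IdealSheafData) (τ : X'' ⟶ X'), Ch X' σ' S' → Literature.AlgebraicGeometry.Resolution.IsBlowup τ C →
    Literature.AlgebraicGeometry.Resolution.Scheme.IsRegular C.subscheme → AlgebraicGeometry.Flat (C.subschemeι ≫ σ' ≫ (AlgebraicGeometry.Proj.toSpecZero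
    (MvPolynomial.homogeneousSubmodule (Fin (n + 1)) O) ≫ AlgebraicGeometry.Spec.map (CommRingCat.ofHom (algebraMap O (MvPolynomial.homogeneousSubmodule (Fin (n + 1)) O 0))))) → σ'
    '' (C.support : Set X') ⊆ {y | ¬ IsGenericPoint y (Set.range (ι ≫ AlgebraicGeometry.Proj.map φ hφ' : H ⟶ AlgebraicGeometry.Proj (MvPolynomial.homogeneousSubmodule (Fin (n + 1))
    O)))} → (C.support : Set X') ∩ (σ' ≫ (AlgebraicGeometry.Proj.toSpecZero (MvPolynomial.homogeneousSubmodule (Fin (n + 1)) O) ≫ AlgebraicGeometry.Spec.map (CommRingCat.ofHom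
    (algebraMap O (MvPolynomial.homogeneousSubmodule (Fin (n + 1)) O 0))))) ⁻¹' {IsLocalRing.closedPoint O} ⊆ S' → Ch X'' (τ ≫ σ') (closure (τ ⁻¹' (S' \ (C.support : Set X'))))) → (∀
    (X' : AlgebraicGeometry.Scheme.{0}) (σ' : X' ⟶ (AlgebraicGeometry.Proj (MvPolynomial.homogeneousSubmodule (Fin (n + 1)) O))) (S' : Set X'), Ch X' σ' S' →
    Summit.ResolutionOfSingularities.ResolutionOfSingularities.Theses.EquisingularLift.Split.Chain (AlgebraicGeometry.Proj (MvPolynomial.homogeneousSubmodule (Fin (n + 1)) O))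
    (Set.range (ι ≫ AlgebraicGeometry.Proj.map φ hφ' : H ⟶ AlgebraicGeometry.Proj (MvPolynomial.homogeneousSubmodule (Fin (n + 1)) O))) X' σ' S') → (Set.range (ι ≫
    AlgebraicGeometry.Proj.map φ hφ' : H ⟶ AlgebraicGeometry.Proj (MvPolynomial.homogeneousSubmodule (Fin (n + 1)) O))) ⊆ (AlgebraicGeometry.Proj.toSpecZero
    (MvPolynomial.homogeneousSubmodule (Fin (n + 1)) O) ≫ AlgebraicGeometry.Spec.map (CommRingCat.ofHom (algebraMap O (MvPolynomial.homogeneousSubmodule (Fin (n + 1)) O 0)))) ⁻¹'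
    {IsLocalRing.closedPoint O} → IsIrreducible (Set.range (ι ≫ AlgebraicGeometry.Proj.map φ hφ' : H ⟶ AlgebraicGeometry.Proj (MvPolynomial.homogeneousSubmodule (Fin (n + 1)) O))) →
    IsClosed (Set.range (ι ≫ AlgebraicGeometry.Proj.map φ hφ' : H ⟶ AlgebraicGeometry.Proj (MvPolynomial.homogeneousSubmodule (Fin (n + 1)) O))) → AlgebraicGeometry.IsIntegral
    (AlgebraicGeometry.Proj (MvPolynomial.homogeneousSubmodule (Fin (n + 1)) O)) → IsLocallyNoetherian (AlgebraicGeometry.Proj (MvPolynomial.homogeneousSubmodule (Fin (n + 1)) O)) →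
    Literature.AlgebraicGeometry.Resolution.Scheme.IsRegular (AlgebraicGeometry.Proj (MvPolynomial.homogeneousSubmodule (Fin (n + 1)) O)) → AlgebraicGeometry.IsProper
    (AlgebraicGeometry.Proj.toSpecZero (MvPolynomial.homogeneousSubmodule (Fin (n + 1)) O) ≫ AlgebraicGeometry.Spec.map (CommRingCat.ofHom (algebraMap O
    (MvPolynomial.homogeneousSubmodule (Fin (n + 1)) O 0)))) → AlgebraicGeometry.SmoothOfRelativeDimension n (AlgebraicGeometry.Proj.toSpecZero (MvPolynomial.homogeneousSubmodule
    (Fin (n + 1)) O) ≫ AlgebraicGeometry.Spec.map (CommRingCat.ofHom (algebraMap O (MvPolynomial.homogeneousSubmodule (Fin (n + 1)) O 0)))) → Ch (AlgebraicGeometry.Proj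
    (MvPolynomial.homogeneousSubmodule (Fin (n + 1)) O)) (𝟙 (AlgebraicGeometry.Proj (MvPolynomial.homogeneousSubmodule (Fin (n + 1)) O))) (Set.range (ι ≫ AlgebraicGeometry.Proj.map φ
    hφ' : H ⟶ AlgebraicGeometry.Proj (MvPolynomial.homogeneousSubmodule (Fin (n + 1)) O))) → AlgebraicGeometry.IsDominant (𝟙 (AlgebraicGeometry.Proj
    (MvPolynomial.homogeneousSubmodule (Fin (n + 1)) O)) ≫ (AlgebraicGeometry.Proj.toSpecZero (MvPolynomial.homogeneousSubmodule (Fin (n + 1)) O) ≫ AlgebraicGeometry.Spec.map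
    (CommRingCat.ofHom (algebraMap O (MvPolynomial.homogeneousSubmodule (Fin (n + 1)) O 0))))) → AlgebraicGeometry.IsIntegral (Literature.AlgebraicGeometry.Motives.projectiveSpace n
    k).left → ∀ (t : (Literature.AlgebraicGeometry.Motives.projectiveSpace n k).left ⟶ AlgebraicGeometry.Spec (.of k)), IsPullback (AlgebraicGeometry.Proj.map φ hφ' :
    (Literature.AlgebraicGeometry.Motives.projectiveSpace n k).left ⟶ AlgebraicGeometry.Proj (MvPolynomial.homogeneousSubmodule (Fin (n + 1)) O)) t (𝟙 (AlgebraicGeometry.Proj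
    (MvPolynomial.homogeneousSubmodule (Fin (n + 1)) O)) ≫ (AlgebraicGeometry.Proj.toSpecZero (MvPolynomial.homogeneousSubmodule (Fin (n + 1)) O) ≫ AlgebraicGeometry.Spec.map
    (CommRingCat.ofHom (algebraMap O (MvPolynomial.homogeneousSubmodule (Fin (n + 1)) O 0))))) (AlgebraicGeometry.Spec.map (CommRingCat.ofHom θ)) → IsClosed (Set.range ι) →
    IsIrreducible (Set.range ι) → (AlgebraicGeometry.Proj.map φ hφ' : (Literature.AlgebraicGeometry.Motives.projectiveSpace n k).left ⟶ AlgebraicGeometry.Proj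
    (MvPolynomial.homogeneousSubmodule (Fin (n + 1)) O)) '' Set.range ι = (Set.range (ι ≫ AlgebraicGeometry.Proj.map φ hφ' : H ⟶ AlgebraicGeometry.Proj
    (MvPolynomial.homogeneousSubmodule (Fin (n + 1)) O))) → ∀ (x : (Literature.AlgebraicGeometry.Motives.projectiveSpace n k).left) (hx : IsClosed ({x} : Set
    (Literature.AlgebraicGeometry.Motives.projectiveSpace n k).left)) (U : (AlgebraicGeometry.Proj (MvPolynomial.homogeneousSubmodule (Fin (n + 1)) O)).Opens),
    AlgebraicGeometry.Smooth (U.ι ≫ 𝟙 (AlgebraicGeometry.Proj (MvPolynomial.homogeneousSubmodule (Fin (n + 1)) O)) ≫ (AlgebraicGeometry.Proj.toSpecZero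
    (MvPolynomial.homogeneousSubmodule (Fin (n + 1)) O) ≫ AlgebraicGeometry.Spec.map (CommRingCat.ofHom (algebraMap O (MvPolynomial.homogeneousSubmodule (Fin (n + 1)) O 0))))) → ∀ (s
    : AlgebraicGeometry.Spec (.of O) ⟶ (AlgebraicGeometry.Proj (MvPolynomial.homogeneousSubmodule (Fin (n + 1)) O))), s ≫ 𝟙 (AlgebraicGeometry.Proj (MvPolynomial.homogeneousSubmodule
    (Fin (n + 1)) O)) ≫ (AlgebraicGeometry.Proj.toSpecZero (MvPolynomial.homogeneousSubmodule (Fin (n + 1)) O) ≫ AlgebraicGeometry.Spec.map (CommRingCat.ofHom (algebraMap O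
    (MvPolynomial.homogeneousSubmodule (Fin (n + 1)) O 0)))) = 𝟙 _ → s (IsLocalRing.closedPoint O) ∈ U → s (IsLocalRing.closedPoint O) = (AlgebraicGeometry.Proj.map φ hφ' :
    (Literature.AlgebraicGeometry.Motives.projectiveSpace n k).left ⟶ AlgebraicGeometry.Proj (MvPolynomial.homogeneousSubmodule (Fin (n + 1)) O)) x → ringKrullDim
    ((AlgebraicGeometry.Proj (MvPolynomial.homogeneousSubmodule (Fin (n + 1)) O)).presheaf.stalk (s (IsLocalRing.closedPoint O))) = ((n + 1 : ℕ) : WithBot ℕ∞) → IsRegularLocalRing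
    ((Literature.AlgebraicGeometry.Motives.projectiveSpace n k).left.presheaf.stalk x) → (∀ c ∈ (s.ker.support : Set (AlgebraicGeometry.Proj (MvPolynomial.homogeneousSubmodule (Fin
    (n + 1)) O))), ¬ IsGenericPoint ((𝟙 (AlgebraicGeometry.Proj (MvPolynomial.homogeneousSubmodule (Fin (n + 1)) O)) : (AlgebraicGeometry.Proj (MvPolynomial.homogeneousSubmodule (Fin
    (n + 1)) O)) ⟶ (AlgebraicGeometry.Proj (MvPolynomial.homogeneousSubmodule (Fin (n + 1)) O))) c) (Set.range (ι ≫ AlgebraicGeometry.Proj.map φ hφ' : H ⟶ AlgebraicGeometry.Proj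
    (MvPolynomial.homogeneousSubmodule (Fin (n + 1)) O)))) → ∀ (X₁ : AlgebraicGeometry.Scheme.{0}) (τ₁ : X₁ ⟶ (AlgebraicGeometry.Proj (MvPolynomial.homogeneousSubmodule (Fin (n + 1))
    O))), Literature.AlgebraicGeometry.Resolution.IsBlowup τ₁ s.ker → AlgebraicGeometry.IsIntegral X₁ → IsLocallyNoetherian X₁ →
    Literature.AlgebraicGeometry.Resolution.Scheme.IsRegular X₁ → AlgebraicGeometry.IsDominant ((τ₁ ≫ 𝟙 (AlgebraicGeometry.Proj (MvPolynomial.homogeneousSubmodule (Fin (n + 1)) O)))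
    ≫ (AlgebraicGeometry.Proj.toSpecZero (MvPolynomial.homogeneousSubmodule (Fin (n + 1)) O) ≫ AlgebraicGeometry.Spec.map (CommRingCat.ofHom (algebraMap O
    (MvPolynomial.homogeneousSubmodule (Fin (n + 1)) O 0))))) → ∀ (F₂ : AlgebraicGeometry.Scheme.{0}), AlgebraicGeometry.IsIntegral F₂ → ∀ (υ : F₂ ⟶
    (Literature.AlgebraicGeometry.Motives.projectiveSpace n k).left), Literature.AlgebraicGeometry.Resolution.IsBlowup υ (AlgebraicGeometry.Scheme.IdealSheafData.vanishingIdeal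
    (⟨{x}, hx⟩ : TopologicalSpace.Closeds (Literature.AlgebraicGeometry.Motives.projectiveSpace n k).left)) → ∀ (j₂ : F₂ ⟶ X₁) (t₂ : F₂ ⟶ AlgebraicGeometry.Spec (.of k)), IsPullback
    j₂ t₂ ((τ₁ ≫ 𝟙 (AlgebraicGeometry.Proj (MvPolynomial.homogeneousSubmodule (Fin (n + 1)) O))) ≫ (AlgebraicGeometry.Proj.toSpecZero (MvPolynomial.homogeneousSubmodule (Fin (n + 1))
    O) ≫ AlgebraicGeometry.Spec.map (CommRingCat.ofHom (algebraMap O (MvPolynomial.homogeneousSubmodule (Fin (n + 1)) O 0))))) (AlgebraicGeometry.Spec.map (CommRingCat.ofHom θ)) → j₂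
    ≫ τ₁ = υ ≫ (AlgebraicGeometry.Proj.map φ hφ' : (Literature.AlgebraicGeometry.Motives.projectiveSpace n k).left ⟶ AlgebraicGeometry.Proj (MvPolynomial.homogeneousSubmodule (Fin (n
    + 1)) O)) → (s.ker.comap τ₁).comap j₂ = (AlgebraicGeometry.Scheme.IdealSheafData.vanishingIdeal (⟨{x}, hx⟩ : TopologicalSpace.Closeds
    (Literature.AlgebraicGeometry.Motives.projectiveSpace n k).left)).comap υ → IsIrreducible (closure (υ ⁻¹' (Set.range ι \ {x}))) → Ch X₁ (τ₁ ≫ 𝟙 (AlgebraicGeometry.Proj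
    (MvPolynomial.homogeneousSubmodule (Fin (n + 1)) O))) (j₂ '' closure (υ ⁻¹' (Set.range ι \ {x}))) → ∀ (Ls₂ : List (Set F₂)),
    (letI := MvPolynomial.gradedAlgebra (σ := Fin (n + 1)) (R := k); ∀ L ∈ Ls₂, ∃ ℓ : MvPolynomial (Fin (n + 1)) k, ℓ.IsHomogeneous 1 ∧ ℓ ≠ 0 ∧ x ∈ {y :
    (Literature.AlgebraicGeometry.Motives.projectiveSpace n k).left | ℓ ∈ (y : ProjectiveSpectrum (MvPolynomial.homogeneousSubmodule (Fin (n + 1)) k)).asHomogeneousIdeal} ∧ ¬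
    (Set.range ι ⊆ {y : (Literature.AlgebraicGeometry.Motives.projectiveSpace n k).left | ℓ ∈ (y : ProjectiveSpectrum (MvPolynomial.homogeneousSubmodule (Fin (n + 1))
    k)).asHomogeneousIdeal}) ∧ L = closure (υ ⁻¹' ({y : (Literature.AlgebraicGeometry.Motives.projectiveSpace n k).left | ℓ ∈ (y : ProjectiveSpectrum
    (MvPolynomial.homogeneousSubmodule (Fin (n + 1)) k)).asHomogeneousIdeal} \ {x}))) → ∀ (F₉ : AlgebraicGeometry.Scheme.{0}) (β : F₉ ⟶ F₂) (T₉ : Set F₉), ReachTowerBQuadPrime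
    (Literature.AlgebraicGeometry.Motives.projectiveSpace n k).left F₂ υ x (closure (υ ⁻¹' (Set.range ι \ {x}))) Ls₂ F₉ β T₉ → ∃ (X₉ : AlgebraicGeometry.Scheme.{0}) (σ₉ : X₉ ⟶
    (AlgebraicGeometry.Proj (MvPolynomial.homogeneousSubmodule (Fin (n + 1)) O))) (S₉ : Set X₉) (j₉ : F₉ ⟶ X₉) (t₉ : F₉ ⟶ AlgebraicGeometry.Spec (.of k)), Ch X₉ σ₉ S₉ ∧
    AlgebraicGeometry.IsIntegral X₉ ∧ IsLocallyNoetherian X₉ ∧ Literature.AlgebraicGeometry.Resolution.Scheme.IsRegular X₉ ∧ AlgebraicGeometry.IsDominant (σ₉ ≫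
    (AlgebraicGeometry.Proj.toSpecZero (MvPolynomial.homogeneousSubmodule (Fin (n + 1)) O) ≫ AlgebraicGeometry.Spec.map (CommRingCat.ofHom (algebraMap O
    (MvPolynomial.homogeneousSubmodule (Fin (n + 1)) O 0))))) ∧ IsPullback j₉ t₉ (σ₉ ≫ (AlgebraicGeometry.Proj.toSpecZero (MvPolynomial.homogeneousSubmodule (Fin (n + 1)) O) ≫
    AlgebraicGeometry.Spec.map (CommRingCat.ofHom (algebraMap O (MvPolynomial.homogeneousSubmodule (Fin (n + 1)) O 0))))) (AlgebraicGeometry.Spec.map (CommRingCat.ofHom θ)) ∧ j₉ ''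
    T₉ = S₉ ∧ IsClosed T₉ ∧ IsIrreducible T₉ ∧ AlgebraicGeometry.IsIntegral F₉)) →
    -- the POINTWISE ND round (brick `ndInvLNP_round` below = re-cuts (P1)–(P3) of the 35th's chain)
    ND.RoundFacts n k (ND.NDInvCLNP n k) →
    -- (K6-1P) the pointwise ND-LEAVES hypothesis
    IsoHypReachNDLeavesP k n H ι → ELNatConclusionO k n H ι := by
  intro hp k _ _ _ n H ι hι hH hloc HSUB₁ HSUB₂ hround h
  obtain ⟨F, ρ, T, m, hpre, hND⟩ := h
  -- the ND rounds from the prefix's END STAGE (`ND.rounds_resolve` is stage-generic): a resolved end reachable through every round-closed motive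
  obtain ⟨F', ρ', T', hQ', hreg'⟩ := ND.rounds_resolve n k (ND.NDInvCLNP n k) (ND.ndInvCLNP_end n k) hround m F ρ T hND
  exact target_elnat_of_subchainResolution_letters p hp k n H ι hι hH hloc
    -- Reach := B‴ towers OR toric strata towers (the O-side lifts either: HSUB₁ resp. `ND.hsub_strataLift`, 35th ✓ p647090)
    (fun F₁ F₂ υ x T₂ F₉ β T₉ => ReachTowerBTriplePrime F₁ F₂ υ x T₂ F₉ β T₉ ∨ ND.ReachToric n F₁ F₂ υ x T₂ F₉ β T₉)
    (fun F₂ υ x T₂ Ls₂ F₉ β T₉ => ReachTowerBQuadPrime (Literature.AlgebraicGeometry.Motives.projectiveSpace n k).left F₂ υ x T₂ Ls₂ F₉ β T₉)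
    (fun F₂ υ x Ls₂ => (letI := MvPolynomial.gradedAlgebra (σ := Fin (n + 1)) (R := k); ∀ L ∈ Ls₂, ∃ ℓ : MvPolynomial (Fin (n + 1)) k, ℓ.IsHomogeneous 1 ∧ ℓ ≠ 0 ∧ x ∈ {y : (Literature.AlgebraicGeometry.Motives.projectiveSpace n k).left | ℓ ∈ (y : ProjectiveSpectrum (MvPolynomial.homogeneousSubmodule (Fin (n + 1)) k)).asHomogeneousIdeal} ∧ ¬ (Set.range ι ⊆ {y : (Literature.AlgebraicGeometry.Motives.projectiveSpace n k).left | ℓ ∈ (y : ProjectiveSpectrum (MvPolynomial.homogeneousSubmodule (Fin (n + 1)) k)).asHomogeneousIdeal}) ∧ L = closure (υ ⁻¹' ({y : (Literature.AlgebraicGeometry.Motives.projectiveSpace n k).left | ℓ ∈ (y : ProjectiveSpectrum (MvPolynomial.homogeneousSubmodule (Fin (n + 1)) k)).asHomogeneousIdeal} \ {x}))))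
    -- HSUB(B‴ ∨ toric) by cases
    (fun O _ _ _ _ _ θ hθ P q Y Ch hChStep hChSplit hYsp hYirr hYcl hPint hPnoeth hPreg hqprop hqsm X' σ' S' hCh' hX'int hX'noeth hX'reg hX'dom F₁ hF₁ j t
        hsq T₁ hT₁cl hT₁irr hjT₁ x hx U hU s hs hsU hsx hdim hxreg hsoff X₁ τ₁ hτ₁ hX₁int hX₁noeth hX₁reg hX₁dom F₂ hF₂ υ hυ j₂ t₂ hsq₂ hcomm hcarrier hirr₂ hCh₁ F₉ β T₉ hR =>
      Or.elim hR
        (fun h₁ => HSUB₁ O θ hθ P q Y Ch hChStep hChSplit hYsp hYirr hYcl hPint hPnoeth hPreg hqprop hqsm X' σ' S' hCh' hX'int hX'noeth hX'reg hX'dom F₁ hF₁ j t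
          hsq T₁ hT₁cl hT₁irr hjT₁ x hx U hU s hs hsU hsx hdim hxreg hsoff X₁ τ₁ hτ₁ hX₁int hX₁noeth hX₁reg hX₁dom F₂ hF₂ υ hυ j₂ t₂ hsq₂ hcomm hcarrier hirr₂ hCh₁ F₉ β T₉ h₁)
        (fun h₂ => ND.hsub_strataLift k n O θ hθ P q Y Ch hChStep hChSplit hYsp hYirr hYcl hPint hPnoeth hPreg hqprop hqsm X' σ' S' hCh' hX'int hX'noeth hX'reg hX'dom F₁ hF₁ j t
          hsq T₁ hT₁cl hT₁irr hjT₁ x hx U hU s hs hsU hsx hdim hxreg hsoff X₁ τ₁ hτ₁ hX₁int hX₁noeth hX₁reg hX₁dom F₂ hF₂ υ hυ j₂ t₂ hsq₂ hcomm hcarrier hirr₂ hCh₁ F₉ β T₉ h₂))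
    HSUB₂
    ⟨F', ρ', T', fun Q hQ0 hQc hQL => hQ' Q
        (fun F₁ F₂ ρ₁ T₁ x υ hx hQ hn hr hυ => ⟨(hQc F₁ F₂ ρ₁ T₁ x υ hx hQ hn hr hυ).1,
          fun F₉ β T₉ hR => (hQc F₁ F₂ ρ₁ T₁ x υ hx hQ hn hr hυ).2 F₉ β T₉ (Or.inr hR)⟩)
        (hpre Q hQ0 (fun F₁ F₂ ρ₁ T₁ x υ hx hQ hn hr hυ => ⟨(hQc F₁ F₂ ρ₁ T₁ x υ hx hQ hn hr hυ).1,
          fun F₉ β T₉ hR => (hQc F₁ F₂ ρ₁ T₁ x υ hx hQ hn hr hυ).2 F₉ β T₉ (Or.inl hR)⟩) hQL), hreg'⟩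

/-- **THE OPTION-(i) ROUND `ndInvLNP_round` — DERIVED** (v2): (B4-round-LN₀) from (B4α′-LN₀) `ND.roundAtNDFrameLN₀` and the brick `ND.ndInvPersists₀` (§L0);
sorry-cone = ∅ since v6 (the four re-lands `transportInit₀`, `transportStep₀`, `transportEnd₀`, `ndInvPersists₀` are tree theorems — audit §(2), no new mathematics). [OURS · pure logic] -/
theorem ndInvLNP_round (n : ℕ) (k : Type) [Field k] [IsAlgClosed k] : ND.RoundFacts n k (ND.NDInvCLNP n k) :=
  ND.ndInvLNP_round_of n k (ND.roundAtNDFrameLN₀ n k) (ND.ndInvPersists₀ n k)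

/-- **THE P-RUNG `nd_leaves_rung_threeP` (n = 3)**: v2's rung VERBATIM with the pointwise blob `IsoHypReachNDLeavesP` — the customer certifies NO global
regularity of the prefix end, only `ND.IsNDFrameAt` data at the finitely many non-regular points of the reduced strict transform (+ `T` closed, `F` locally
Noetherian).  Sorry-cone = {`ndInvLNP_round`} ∪ F-88. [OURS · L1 W4.5b · candidate rung of the 37th cut under option (i); NOT a statement of the manuscript] -/
theorem nd_leaves_rung_threeP (p : ℕ) : EmbeddedCurveLiftFact → p.Prime → ∀ (k : Type) [Field k] [CharP k p] [IsAlgClosed k] (H :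
    AlgebraicGeometry.Scheme.{0}) (ι : H ⟶ (Literature.AlgebraicGeometry.Motives.projectiveSpace 3 k).left), AlgebraicGeometry.IsClosedImmersion ι →
    AlgebraicGeometry.IsIntegral H → (∀ y : (Literature.AlgebraicGeometry.Motives.projectiveSpace 3 k).left, ∃ U : (Literature.AlgebraicGeometry.Motives.projectiveSpace 3
    k).left.affineOpens, y ∈ (U : (Literature.AlgebraicGeometry.Motives.projectiveSpace 3 k).left.Opens) ∧ (ι.ker.ideal U).IsPrincipal) →
    IsoHypReachNDLeavesP k 3 H ι → ELNatConclusionO k 3 H ι:= by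
  intro hFact hp k _ _ _ H ι hι hH hloc h
  exact target_elnat_of_prefix_then_ndRoundsP p hp k 3 H ι hι hH hloc
    -- HSUB₁ (abstract stage, no letters): rung⁗'s supplier VERBATIM — stub-4's V10⁗-full ∘ (T-k) ∘ res-type-027's `inv_baseSL`
    (fun O _ _ _ _ _ θ hθ P q Y Ch hChStep hChSplit hYsp hYirr hYcl hPint hPnoeth hPreg hqprop hqsm X' σ' S' hCh' hX'int hX'noeth hX'reg hX'dom F₁ hF₁ j t
        hsq T₁ hT₁cl hT₁irr hjT₁ x hx U hU s hs hsU hsx hdim hxreg hsoff X₁ τ₁ hτ₁ hX₁int hX₁noeth hX₁reg hX₁dom F₂ hF₂ υ hυ j₂ t₂ hsq₂ hcomm hcarrier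
        hirr₂ hCh₁ =>
      hsub_reachTowerBTriplePrime_of_fact_full k O θ hθ P q Y Ch hChStep hChSplit hYsp hYirr hYcl hPint hPnoeth hPreg hqprop hqsm X' σ' S' hCh' hX'int hX'noeth
        hX'reg hX'dom F₁ hF₁ j t hsq T₁ hT₁cl hT₁irr hjT₁ x hx U hU s hs hsU hsx hdim hxreg hsoff X₁ τ₁ hτ₁ hX₁int hX₁noeth hX₁reg hX₁dom F₂ hF₂ υ hυ
        j₂ t₂ hsq₂ hcomm hcarrier hirr₂ hCh₁ (hFact k O θ hθ P q)
        -- the SL-BASE (plane list seeded `[υ⁻¹{x}]`, conical `W`): res-type-027's `inv_baseSL` (A‴ (U6)), in characteristic `p` of `k`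
        (fun W _ hnot _ hcone => by
          haveI : Fact p.Prime := ⟨hp⟩
          haveI := hqprop; haveI := hX'int; haveI := hX'noeth; haveI := hF₁; haveI := hX₁int; haveI := hX₁noeth; haveI := hF₂
          exact inv_baseSL p k O θ hθ P q Y Ch hChSplit hPnoeth hPreg X' σ' S' hCh' hX'reg F₁ j t hsq T₁ x hx hxreg U hU s hs hsU hsx hdim hsoff X₁
            τ₁ hτ₁ hX₁reg hX₁dom F₂ υ hυ j₂ t₂ hsq₂ hcomm hcarrier hCh₁ hirr₂ W hnot hcone))
    -- HSUB₂ (initial stage, hyperplane letters): stub-4's V10⁵-full, seeds by res-type-027's lettered bases, letter data by (H3) + (H4-T)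
    (fun O _ _ _ _ _ θ hθ φ hφ' hφ Ch hChStep hChSplit hYsp hYirr hYcl hPint hPnoeth hPreg hqprop hqsm hCh₀ hdom₀ hF₁int t hsq hT₁cl hT₁irr hjT₁ x hx U hU s hs hsU
        hsx hdim hxreg hsoff X₁ τ₁ hτ₁ hX₁int hX₁noeth hX₁reg hX₁dom F₂ hF₂ υ hυ j₂ t₂ hsq₂ hcomm hcarrier hirr₂ hCh₁ Ls₂ hLS => by
      haveI : Fact p.Prime := ⟨hp⟩
      haveI := hqprop; haveI := hPint; haveI := hPnoeth; haveI := hF₁int; haveI := hX₁int; haveI := hX₁noeth; haveI := hF₂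
      -- `ℙⁿ_k` is locally Noetherian: `Proj φ` is a closed immersion into the locally Noetherian `ℙⁿ_O` (base change of `Spec θ`)
      haveI : IsClosedImmersion (Spec.map (CommRingCat.ofHom θ)) := IsClosedImmersion.spec_of_surjective _ hθ
      have hjci : IsClosedImmersion (Proj.map φ hφ' : (Literature.AlgebraicGeometry.Motives.projectiveSpace 3 k).left ⟶
          Proj (MvPolynomial.homogeneousSubmodule (Fin (3 + 1)) O)) :=
        MorphismProperty.IsStableUnderBaseChange.of_isPullback hsq.flip inferInstance
      have hjfin := ((IsClosedImmersion.iff_isFinite_and_mono _).mp hjci).1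
      have hjft := ((IsFinite.iff_isIntegralHom_and_locallyOfFiniteType _).mp hjfin).2
      haveI : IsLocallyNoetherian (Literature.AlgebraicGeometry.Motives.projectiveSpace 3 k).left :=
        @LocallyOfFiniteType.isLocallyNoetherian _ _ _ hjft hPnoeth
      -- `range ι` is not the point `x` (its strict transform is non-empty)
      have hTx : ¬ Set.range ι ⊆ {x} := by
        obtain ⟨y, hy⟩ := closure_nonempty_iff.mp hirr₂.nonempty
        exact fun h => hy.2 (h hy.1)
      -- the hyperplanes `V₊(ℓ)` are closed (a zero locus of the projective spectrum)
      have hVcl : ∀ ℓ : MvPolynomial (Fin (3 + 1)) k, IsClosed {y : (Literature.AlgebraicGeometry.Motives.projectiveSpace 3 k).left |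
          ℓ ∈ (y : ProjectiveSpectrum (MvPolynomial.homogeneousSubmodule (Fin (3 + 1)) k)).asHomogeneousIdeal} := fun ℓ => by
        have h := ProjectiveSpectrum.isClosed_zeroLocus (MvPolynomial.homogeneousSubmodule (Fin (3 + 1)) k)
          ({ℓ} : Set (MvPolynomial (Fin (3 + 1)) k))
        have hS : {y : ProjectiveSpectrum (MvPolynomial.homogeneousSubmodule (Fin (3 + 1)) k) | ℓ ∈ y.asHomogeneousIdeal} =
            ProjectiveSpectrum.zeroLocus (MvPolynomial.homogeneousSubmodule (Fin (3 + 1)) k) {ℓ} :=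
          Set.ext fun y => by simp only [ProjectiveSpectrum.mem_zeroLocus, Set.mem_setOf_eq, Set.singleton_subset_iff, SetLike.mem_coe]
        rw [← hS] at h
        exact h
      -- the letters' downstairs bookkeeping: closed, not containing the strict transform of `range ι`
      have hLs₂ : ∀ L ∈ Ls₂, IsClosed L ∧ ¬ closure (υ ⁻¹' (Set.range ι \ {x})) ⊆ L := by
        intro L hL
        obtain ⟨ℓ, -, -, -, hHℓ, rfl⟩ := hLS L hL
        exact ⟨isClosed_closure, not_closure_preimage_diff_subset hυ hT₁irr (hVcl ℓ) hx hHℓ hTx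
          (Scheme.IdealSheafData.coe_support_vanishingIdeal _).le⟩
      -- the letters' MODEL data at `(X₁, τ₁ ≫ 𝟙, j₂)`: (H3) a hyperplane model through the section, then (H4-T) its strict transform
      have hLsD : ∀ L ∈ Ls₂, TCPlus.LetterDatum O (Proj (MvPolynomial.homogeneousSubmodule (Fin (3 + 1)) O))
          (Proj.toSpecZero (MvPolynomial.homogeneousSubmodule (Fin (3 + 1)) O) ≫
            Spec.map (CommRingCat.ofHom (algebraMap O (MvPolynomial.homogeneousSubmodule (Fin (3 + 1)) O 0))))
          (Set.range (ι ≫ Proj.map φ hφ')) F₂ X₁ (τ₁ ≫ 𝟙 _) j₂ L := by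
        intro L hL
        obtain ⟨ℓ, hℓ1, hℓ0, hxℓ, hHℓ, rfl⟩ := hLS L hL
        obtain ⟨-, -, fO, hfO', -, -, -, -, h1, h2, h3, h4, h5, hle⟩ :=
          @LinearLetter.exists_letter_model_le_ker O k _ _ _ _ θ hθ 2 φ hφ hφ' s hs x hsx ℓ hℓ1 hℓ0 hxℓ H hH ι hι hHℓ
        have hVne : closure {y : (Literature.AlgebraicGeometry.Motives.projectiveSpace 3 k).left |
            ℓ ∈ (y : ProjectiveSpectrum (MvPolynomial.homogeneousSubmodule (Fin (3 + 1)) k)).asHomogeneousIdeal} ≠ Set.univ := by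
          rw [(hVcl ℓ).closure_eq]
          exact fun h => hHℓ (h ▸ Set.subset_univ _)
        exact letter_strictTransform_of_le_ker k O θ hθ _ _ _ _ (𝟙 _) hPreg _ (Proj.map φ hφ') t hsq x hx s hs hsx X₁ τ₁ hτ₁ F₂ υ hυ j₂ hcomm
          _ _ hVne h1 h2 h3 h4 h5 hle
      exact hsub_reachTowerBQuadPrime_of_fact_full k O θ hθ _ _ _ Ch hChStep hChSplit hYsp hYirr hYcl hPint hPnoeth hPreg hqprop hqsm _ (𝟙 _) _ hCh₀ hPint
        hPnoeth hPreg hdom₀ _ hF₁int (Proj.map φ hφ') t hsq (Set.range ι) hT₁cl hT₁irr hjT₁ x hx U hU s hs hsU hsx hdim hxreg hsoff X₁ τ₁ hτ₁ hX₁int hX₁noeth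
        hX₁reg hX₁dom F₂ hF₂ υ hυ j₂ t₂ hsq₂ hcomm hcarrier hirr₂ hCh₁ Ls₂ hLs₂ (hFact k O θ hθ _ _)
        -- the SL-BASE with letters (conical `W`): res-type-027's `inv_baseSL_letters`, in characteristic `p` of `k`
        (fun W _ hnot _ hcone =>
          inv_baseSL_letters p k O θ hθ _ _ _ Ch hChSplit hPnoeth hPreg _ (𝟙 _) _ hCh₀ hPreg _ (Proj.map φ hφ') t hsq (Set.range ι) x hx hxreg U hU s hs hsU
            hsx hdim hsoff X₁ τ₁ hτ₁ hX₁reg hX₁dom F₂ υ hυ j₂ t₂ hsq₂ hcomm hcarrier hCh₁ hirr₂ W hnot hcone Ls₂ hLsD)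
        -- the S₀L-BASE with letters (shadow-free `W`): res-type-027's `inv_baseS₀L_letters` (char-free)
        (fun W hxW hnot hWpr =>
          inv_baseS₀L_letters k O θ hθ _ _ _ Ch hChSplit hPnoeth hPreg _ (𝟙 _) _ hCh₀ hPreg _ (Proj.map φ hφ') t hsq (Set.range ι) x hx hxreg U hU s hs hsU
            hsx hdim hsoff X₁ τ₁ hτ₁ hX₁reg hX₁dom F₂ υ hυ j₂ t₂ hsq₂ hcomm hcarrier hCh₁ hirr₂ W hxW hnot hWpr Ls₂ hLsD))
    -- the POINTWISE ND round (brick), and the pointwise ND-LEAVES hypothesis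
    (ndInvLNP_round 3 k) h

/-- v2's rung RE-DERIVED from the P-rung (monotonicity `isoHypReachNDLeavesP_of`): option (i) loses nothing. [OURS · pure logic] -/
theorem nd_leaves_rung_three_of_P (p : ℕ) : EmbeddedCurveLiftFact → p.Prime → ∀ (k : Type) [Field k] [CharP k p] [IsAlgClosed k] (H :
    AlgebraicGeometry.Scheme.{0}) (ι : H ⟶ (Literature.AlgebraicGeometry.Motives.projectiveSpace 3 k).left), AlgebraicGeometry.IsClosedImmersion ι →
    AlgebraicGeometry.IsIntegral H → (∀ y : (Literature.AlgebraicGeometry.Motives.projectiveSpace 3 k).left, ∃ U : (Literature.AlgebraicGeometry.Motives.projectiveSpace 3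
    k).left.affineOpens, y ∈ (U : (Literature.AlgebraicGeometry.Motives.projectiveSpace 3 k).left.Opens) ∧ (ι.ker.ideal U).IsPrincipal) →
    IsoHypReachNDLeaves k 3 H ι → ELNatConclusionO k 3 H ι:= by
  intro hFact hp k _ _ _ H ι hι hH hloc h
  exact nd_leaves_rung_threeP p hFact hp k H ι hι hH hloc (isoHypReachNDLeavesP_of k 3 H ι h)

end Summit.ResolutionOfSingularities.ResolutionOfSingularities.Cruxes.EquisingularLiftNat.Sections

end
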